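import Summits.PneNP.PneNP.Theorems.SmallBlockRothvossGridNet
import Literature.Barriers.PneNP.TSPExtensionComplexityRothvossKernel
import Literature.Combinatorics.Optimization.PsdFactorizationRescaling
import Literature.Combinatorics.Optimization.EquivariantPsdStructure
import HarnessLib

/-!
# T-SOC / fixed block size (cell pnp-psdrank, rung F-N2.SOC): block accounting at Rothvoß's slot sizes

`accounting_identity`, `Cb`, `core_arith`, `block_core`: for `m = 2μ+1` large and `n = |Slot m 72|`, any `r`-term
`b × b`-block psd factorization of the `t`-cut slack matrix of `P_PM(n)` has
`1 ≤ r · Cb(b) · (t−1)^{2b+1} · θ_R(m)^{1/(b+1)}` (`Cb(b) = 6 b⁴ (20736 b²)^b`). Ingredients: the tree's Rothvoß weight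
datum with dominating kernel `exists_WK_fin`, the weak Briët–Dadush–Pokutta rescaling `HasPsdFactorization.rescale_weak`,
the square-root split `EquivariantPsdStructure.trace_mul_eq_sum_sq_sqrtRow`, and `netSandwich_grid`.
Source: HOME/pnp-psdrank-eng/lean/SocLiftB.lean Part F (eng g3; ref audit object).
-/

set_option linter.dupNamespace false -- `Summit.PneNP.PneNP.…`: summit = sub-problem (D-0017)

noncomputable section

open scoped Classical MatrixOrder

namespace Summit.PneNP.PneNP.Theorems.SmallBlockRothvossGrid

open Finset Matrix Real Literature.Barriers.PneNP Literature.Combinatorics.Optimization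
  Literature.Combinatorics.Optimization.EquivariantPsdStructure

/-- **Abstract accounting**: if `⟨W, S⟩ = 1`, `S = c·Σ_i G_i` (`c ≥ 0`), every piece satisfies
`⟨W, G_i⟩ ≤ E + η⟨K, G_i⟩ + τ ΣK` (`η ≥ 0`) and `⟨K, S⟩ ≤ D`, then `1 ≤ c·|ι|·(E + τ ΣK) + η D`. -/
theorem accounting_identity {α β ι : Type} [Fintype α] [Fintype β] [Fintype ι]
    (W K S : α → β → ℝ) (G : ι → α → β → ℝ) (c E η τ D : ℝ) (hc : 0 ≤ c) (hη : 0 ≤ η)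
    (hsum : ∑ a, ∑ b, W a b * S a b = 1)
    (hS : ∀ a b, S a b = c * ∑ i, G i a b)
    (hG : ∀ i, ∑ a, ∑ b, W a b * G i a b ≤
      E + η * ∑ a, ∑ b, K a b * G i a b + τ * ∑ a, ∑ b, K a b)
    (hKS : ∑ a, ∑ b, K a b * S a b ≤ D) :
    1 ≤ c * Fintype.card ι * (E + τ * ∑ a, ∑ b, K a b) + η * D := by
  have hswap : ∀ V : α → β → ℝ, ∑ a, ∑ b, V a b * S a b = c * ∑ i, ∑ a, ∑ b, V a b * G i a b := by
    intro V
    calc ∑ a, ∑ b, V a b * S a b = ∑ a, ∑ b, ∑ i, c * (V a b * G i a b) := by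
          refine sum_congr rfl fun a _ => sum_congr rfl fun b _ => ?_
          rw [hS a b, mul_sum, mul_sum]
          exact sum_congr rfl fun i _ => by ring
      _ = ∑ i, ∑ a, ∑ b, c * (V a b * G i a b) := sum_sum_sum_comm _ _ _ _
      _ = c * ∑ i, ∑ a, ∑ b, V a b * G i a b := by simp_rw [mul_sum]
  have h1 := hswap W
  have h2 := hswap K
  rw [hsum] at h1
  have h3 : c * ∑ i, ∑ a, ∑ b, W a b * G i a b ≤
      c * ∑ i, (E + η * ∑ a, ∑ b, K a b * G i a b + τ * ∑ a, ∑ b, K a b) :=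
    mul_le_mul_of_nonneg_left (sum_le_sum fun i _ => hG i) hc
  have h4 : c * ∑ i, (E + η * ∑ a, ∑ b, K a b * G i a b + τ * ∑ a, ∑ b, K a b) =
      c * Fintype.card ι * (E + τ * ∑ a, ∑ b, K a b) + η * (c * ∑ i, ∑ a, ∑ b, K a b * G i a b) := by
    simp only [sum_add_distrib, sum_const, card_univ, nsmul_eq_mul, ← mul_sum]
    ring
  rw [h4, ← h2] at h3
  have h5 : η * ∑ a, ∑ b, K a b * S a b ≤ η * D := mul_le_mul_of_nonneg_left hKS hη
  linarith

/-- The constant of the `b`-block bound. -/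
def Cb (b : ℕ) : ℝ := 6 * (b : ℝ) ^ 4 * (20736 * (b : ℝ) ^ 2) ^ b

/-- `Cb(b) > 0`. -/
theorem Cb_pos {b : ℕ} (hb : 1 ≤ b) : 0 < Cb b := by
  unfold Cb
  have : (0 : ℝ) < b := by exact_mod_cast hb
  positivity

/-- The closing arithmetic of `block_core`. -/
theorem core_arith {b : ℕ} {r Δ τ E S : ℝ} (hb : 1 ≤ b) (hΔ2 : 2 ≤ Δ) (hτ : 0 < τ) (hr0 : 0 ≤ r)
    (hS1 : S ≤ 1) (hE : E = (20736 * (b : ℝ) ^ 2 * Δ ^ 2) ^ b * (2 * τ))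
    (key : 1 ≤ (b : ℝ) ^ 2 * Δ * (r * (b : ℝ) ^ 2 * (E + τ * S)) + 1 / 2) :
    1 ≤ r * (Cb b * Δ ^ (2 * b + 1) * τ) := by
  have hbR : (1 : ℝ) ≤ b := by exact_mod_cast hb
  have hΔ0 : 0 < Δ := by linarith
  set P : ℝ := (20736 * (b : ℝ) ^ 2) ^ b with hP
  have hP0 : 0 < P := by rw [hP]; positivity
  have hxP : (20736 * (b : ℝ) ^ 2 * Δ ^ 2) ^ b = P * Δ ^ (2 * b) := by
    rw [hP, mul_pow, ← pow_mul]
  have hb2 : (1 : ℝ) ≤ (b : ℝ) ^ 2 := by nlinarith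
  have hΔsq : (4 : ℝ) ≤ Δ ^ 2 := by nlinarith
  have hbase : (1 : ℝ) ≤ 20736 * (b : ℝ) ^ 2 * Δ ^ 2 := by nlinarith
  have hbase1 : (1 : ℝ) ≤ (20736 * (b : ℝ) ^ 2 * Δ ^ 2) ^ b := one_le_pow₀ hbase
  have hD0 : 0 < Δ ^ (2 * b) := pow_pos hΔ0 _
  have hEτ : E + τ * S ≤ 3 * (P * Δ ^ (2 * b)) * τ := by
    rw [hE, hxP]
    rw [hxP] at hbase1
    have h1 : τ * S ≤ τ := by nlinarith
    nlinarith
  have hpre : 0 ≤ (b : ℝ) ^ 2 * Δ * (r * (b : ℝ) ^ 2) := by positivity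
  have hmain : (1 : ℝ) / 2 ≤ (b : ℝ) ^ 2 * Δ * (r * (b : ℝ) ^ 2) * (3 * (P * Δ ^ (2 * b)) * τ) := by
    have := mul_le_mul_of_nonneg_left hEτ hpre
    linarith
  have hCb : Cb b = 6 * (b : ℝ) ^ 4 * P := by unfold Cb; rw [hP]
  have hpow : Δ ^ (2 * b + 1) = Δ ^ (2 * b) * Δ := pow_succ Δ (2 * b)
  rw [hCb, hpow]
  have hfin : (b : ℝ) ^ 2 * Δ * (r * (b : ℝ) ^ 2) * (3 * (P * Δ ^ (2 * b)) * τ) * 2 =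
      r * (6 * (b : ℝ) ^ 4 * P * (Δ ^ (2 * b) * Δ) * τ) := by ring
  linarith [hfin]

/-- **The `b × b`-block bound at Rothvoß's slot sizes.** For `m = 2μ+1` large and `n = |Slot m 72|`: if the
`t`-cut slack matrix of `P_PM(n)` is a sum of `r` pairings of psd `b × b` blocks (`b ≥ 1`), then
`1 ≤ r · Cb(b) · (t−1)^{2b+1} · θ_R(m)^{1/(b+1)}`, i.e. `r ≥ 2^{δ_R m/(b+1)} / (Cb(b) (t−1)^{2b+1})`. -/
theorem block_core (b : ℕ) (hb : 1 ≤ b) (μ : ℕ) {m : ℕ} (hm : m = 2 * μ + 1)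
    (hU1 : (64 / cU εR) ^ 2 ≤ (m : ℝ) + 1) (hU2 : 32 / cU εR ≤ (m : ℝ) + 1)
    (hM1 : 16 * FQ * Real.log QB / cM qR εR ≤ (m : ℝ)) {r : ℕ}
    (A : {U : Finset (Fin (Fintype.card (Slot m qR))) // U.card = tCut qR μ} →
      Fin r → Matrix (Fin b) (Fin b) ℝ)
    (B : {M : Finset (Sym2 (Fin (Fintype.card (Slot m qR)))) // IsPMOn univ M} →
      Fin r → Matrix (Fin b) (Fin b) ℝ)
    (hA : ∀ a i, (A a i).PosSemidef) (hB : ∀ b' i, (B b' i).PosSemidef)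
    (hfac : ∀ (a : {U : Finset (Fin (Fintype.card (Slot m qR))) // U.card = tCut qR μ})
      (b' : {M : Finset (Sym2 (Fin (Fintype.card (Slot m qR)))) // IsPMOn univ M}),
      ((b'.1.filter (fun f => cutCount a.1 f = 1)).card : ℝ) - 1 = ∑ i, (A a i * B b' i).trace) :
    (1 : ℝ) ≤ r * (Cb b * ((tCut qR μ : ℝ) - 1) ^ (2 * b + 1) * (θR m) ^ ((1 : ℝ) / ((b : ℝ) + 1))) := by
  -- the weight datum
  obtain ⟨W, K, hrect, hsum, hWK, hK0, hKsum⟩ := exists_WK_fin μ hm hU1 hU2 hM1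
  -- parameters
  have hbR : (1 : ℝ) ≤ b := by exact_mod_cast hb
  have ht3 : 3 ≤ tCut qR μ := by unfold tCut; omega
  have hΔ2 : (2 : ℝ) ≤ (tCut qR μ : ℝ) - 1 := by
    have : (3 : ℝ) ≤ (tCut qR μ : ℝ) := by exact_mod_cast ht3
    linarith
  generalize hΔ : ((tCut qR μ : ℝ) - 1) = Δ at hΔ2 ⊢
  have hΔ0 : 0 < Δ := by linarith
  have hθ0 : 0 < θR m := θR_pos m
  generalize hθ : θR m = θ at hrect hθ0 ⊢
  set τ : ℝ := θ ^ ((1 : ℝ) / ((b : ℝ) + 1)) with hτdef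
  have hτ : 0 < τ := Real.rpow_pos_of_pos hθ0 _
  have hτpow : τ ^ b * τ = θ := by
    rw [← pow_succ, hτdef, ← Real.rpow_natCast, ← Real.rpow_mul hθ0.le]
    have : (1 : ℝ) / ((b : ℝ) + 1) * ((b + 1 : ℕ) : ℝ) = 1 := by
      push_cast; field_simp
    rw [this, Real.rpow_one]
  set η : ℝ := 1 / (2 * Δ) with hηdef
  have hη : 0 < η := by rw [hηdef]; positivity
  have hη1 : η ≤ 1 := by
    rw [hηdef, div_le_one (by positivity)]; linarith
  have hηΔ : η * Δ = 1 / 2 := by rw [hηdef]; field_simp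
  -- slack
  have hSΔ : ∀ (a : {U : Finset (Fin (Fintype.card (Slot m qR))) // U.card = tCut qR μ})
      (b' : {M : Finset (Sym2 (Fin (Fintype.card (Slot m qR)))) // IsPMOn univ M}),
      ((b'.1.filter (fun f => cutCount a.1 f = 1)).card : ℝ) - 1 ≤ Δ := by
    intro a b'
    have h1 := b'.2.card_cut_le (subset_univ a.1)
    rw [a.2] at h1
    have h2 : (((b'.1.filter (fun f => cutCount a.1 f = 1)).card : ℕ) : ℝ) ≤ (tCut qR μ : ℝ) := by
      exact_mod_cast h1
    rw [← hΔ]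
    linarith
  -- blocks
  set T : Fin r → {U : Finset (Fin (Fintype.card (Slot m qR))) // U.card = tCut qR μ} →
      {M : Finset (Sym2 (Fin (Fintype.card (Slot m qR)))) // IsPMOn univ M} → ℝ :=
    fun i a b' => (A a i * B b' i).trace with hTdef
  have hST : ∀ a b', ((b'.1.filter (fun f => cutCount a.1 f = 1)).card : ℝ) - 1 = ∑ i, T i a b' :=
    fun a b' => hfac a b'
  have hTfac : ∀ i, HasPsdFactorization (T i) b := fun i =>
    ⟨fun a => A a i, fun b' => B b' i, fun a => hA a i, fun b' => hB b' i, fun a b' => rfl⟩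
  have hT0 : ∀ i a b', 0 ≤ T i a b' := fun i a b' => (hTfac i).entry_nonneg a b'
  have hTΔ : ∀ i a b', T i a b' ≤ Δ := by
    intro i a b'
    have h1 : T i a b' ≤ ∑ j, T j a b' :=
      single_le_sum (f := fun j => T j a b') (fun j _ => hT0 j a b') (mem_univ i)
    linarith [hST a b', hSΔ a b']
  have hresc : ∀ i, ∃ (X : {U : Finset (Fin (Fintype.card (Slot m qR))) // U.card = tCut qR μ} →
        Matrix (Fin b) (Fin b) ℝ)
      (Y : {M : Finset (Sym2 (Fin (Fintype.card (Slot m qR)))) // IsPMOn univ M} →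
        Matrix (Fin b) (Fin b) ℝ),
      (∀ a, (X a).PosSemidef ∧ (1 - X a).PosSemidef) ∧ (∀ b', (Y b').PosSemidef ∧ (1 - Y b').PosSemidef) ∧
      ∀ a b', T i a b' = ((b : ℕ) : ℝ) ^ 2 * Δ * (X a * Y b').trace :=
    fun i => (hTfac i).rescale_weak hΔ0 (hTΔ i)
  choose X Y hX hY hTXY using hresc
  -- the rank-one-vector pieces
  set G : (Fin r × (Fin b × Fin b)) →
      {U : Finset (Fin (Fintype.card (Slot m qR))) // U.card = tCut qR μ} →
      {M : Finset (Sym2 (Fin (Fintype.card (Slot m qR)))) // IsPMOn univ M} → ℝ :=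
    fun ipq a b' => (sqrtRow (X ipq.1 a) ipq.2.1 ⬝ᵥ sqrtRow (Y ipq.1 b') ipq.2.2) ^ 2 with hGdef
  have hS : ∀ (a : {U : Finset (Fin (Fintype.card (Slot m qR))) // U.card = tCut qR μ})
      (b' : {M : Finset (Sym2 (Fin (Fintype.card (Slot m qR)))) // IsPMOn univ M}),
      ((b'.1.filter (fun f => cutCount a.1 f = 1)).card : ℝ) - 1 = ((b : ℝ) ^ 2 * Δ) * ∑ ipq, G ipq a b' := by
    intro a b'
    rw [hST a b', Fintype.sum_prod_type (f := fun ipq : Fin r × (Fin b × Fin b) => G ipq a b'),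
      mul_sum]
    refine sum_congr rfl fun i _ => ?_
    rw [hTXY i a b', trace_mul_eq_sum_sq_sqrtRow (hX i a).1 (hY i b').1,
      Fintype.sum_prod_type (f := fun pq : Fin b × Fin b => G (i, pq) a b')]
  -- per-piece sandwich (grid net in dimension `b`)
  set E : ℝ := (5184 * (b : ℝ) ^ 2 / (η ^ 2 * τ)) ^ b * (2 * θ) with hEdef
  have hpiece : ∀ ipq, ∑ a, ∑ b', W a b' * G ipq a b' ≤
      E + η * ∑ a, ∑ b', K a b' * G ipq a b' + τ * ∑ a, ∑ b', K a b' := by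
    intro ipq
    exact netSandwich_grid hb W K (2 * θ) η τ (fun a => sqrtRow (X ipq.1 a) ipq.2.1)
      (fun b' => sqrtRow (Y ipq.1 b') ipq.2.2) hK0 hWK (by positivity) hη hη1 hτ
      (fun a => sqrtRow_sq_le_one (hX ipq.1 a).1 (hX ipq.1 a).2 _)
      (fun b' => sqrtRow_sq_le_one (hY ipq.1 b').1 (hY ipq.1 b').2 _) hrect
  -- `⟨K, S⟩ ≤ Δ`
  have hKS : ∑ a, ∑ b', K a b' * (((b'.1.filter (fun f => cutCount a.1 f = 1)).card : ℝ) - 1) ≤ Δ := by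
    calc ∑ a, ∑ b', K a b' * (((b'.1.filter (fun f => cutCount a.1 f = 1)).card : ℝ) - 1)
        ≤ ∑ a, ∑ b', K a b' * Δ :=
          sum_le_sum fun a _ => sum_le_sum fun b' _ => mul_le_mul_of_nonneg_left (hSΔ a b') (hK0 a b')
      _ = (∑ a, ∑ b', K a b') * Δ := by rw [sum_mul]; simp_rw [sum_mul]
      _ ≤ 1 * Δ := mul_le_mul_of_nonneg_right hKsum hΔ0.le
      _ = Δ := one_mul Δ
  have key := accounting_identity W K
    (fun a b' => ((b'.1.filter (fun f => cutCount a.1 f = 1)).card : ℝ) - 1) G ((b : ℝ) ^ 2 * Δ) E η τ Δ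
    (by positivity) hη.le hsum hS hpiece hKS
  -- arithmetic
  have hcard : (Fintype.card (Fin r × (Fin b × Fin b)) : ℝ) = r * (b : ℝ) ^ 2 := by
    simp only [Fintype.card_prod, Fintype.card_fin]; push_cast; ring
  rw [hcard, hηΔ] at key
  have hE : E = (20736 * (b : ℝ) ^ 2 * Δ ^ 2) ^ b * (2 * τ) := by
    have hbase_eq : 5184 * (b : ℝ) ^ 2 / (η ^ 2 * τ) = (20736 * (b : ℝ) ^ 2 * Δ ^ 2) / τ := by
      rw [hηdef]; field_simp; ring
    have hτb : τ ^ b ≠ 0 := (pow_pos hτ b).ne'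
    rw [hEdef, hbase_eq, div_pow, ← hτpow]
    field_simp
  have hr0 : (0 : ℝ) ≤ r := Nat.cast_nonneg r
  have key' : 1 ≤ (b : ℝ) ^ 2 * Δ * ((r : ℝ) * (b : ℝ) ^ 2 * (E + τ * ∑ a, ∑ b', K a b')) + 1 / 2 := by
    have e : (b : ℝ) ^ 2 * Δ * ((r : ℝ) * (b : ℝ) ^ 2) * (E + τ * ∑ a, ∑ b', K a b') =
        (b : ℝ) ^ 2 * Δ * ((r : ℝ) * (b : ℝ) ^ 2 * (E + τ * ∑ a, ∑ b', K a b')) := by ring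
    rw [← e]; exact key
  exact core_arith hb hΔ2 hτ hr0 hKsum hE key'

end Summit.PneNP.PneNP.Theorems.SmallBlockRothvossGrid

end
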